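import Mathlib.ModelTheory.Syntax
import Mathlib.ModelTheory.Semantics
import Mathlib.ModelTheory.Satisfiability
import Mathlib.ModelTheory.Complexity
import Mathlib.ModelTheory.Order
import Mathlib.Data.Nat.Size
import HarnessLib

-- provenance: harness21/H21/H21/Prelude/CplxMeta/BoundedArithSyntax.lean @ 7c6a0f5 (interim HEAD d8f2665); M5 mechanical rewrite
/-!
# Buss's language of bounded arithmetic and the `Σᵇᵢ / Πᵇᵢ` hierarchy

Trunk: CplxMeta (G14), item C13 `BoundedArithSyntax` (notion `bounded_arithmetic_theories`,
syntax half; the theories `S₂ⁱ`, `T₂ⁱ` live in `BoundedArithTheories.lean`).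

We set up, inside Mathlib's `FirstOrder` model-theory library, Buss's first-order language
`0, S, ⌊·/2⌋, |·|, +, ·, #, ≤` of bounded arithmetic, its standard model `ℕ`, bounded and sharply
bounded quantifiers, and the syntactic classes of sharply bounded, `Σᵇᵢ`, `Πᵇᵢ` and bounded
formulas. We also add two small generic notions on theories that Mathlib lacks (verified by
grep): axiom-wise extension `Theory.Extends` and `Φ`-conservativity `Theory.IsConservativeOver`.

## Sources

* S. Buss, *Bounded Arithmetic*, Bibliopolis 1986, §1.1 (language), §2.1 (the classes
  `Σᵇᵢ`, `Πᵇᵢ`), §2.2.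
* J. Krajíček, *Bounded Arithmetic, Propositional Logic and Complexity Theory*, CUP 1995, §5.2.

## Mathlib anchors used

`FirstOrder.Language` (pattern: `FirstOrder.Language.presburger` in
`Mathlib/ModelTheory/Arithmetic/Presburger/Basic.lean`), `Language.Structure`,
`Language.IsOrdered` / `Language.OrderedStructure` and `Term.le`, `Term.lt`, `Term.realize_le`
(`Mathlib/ModelTheory/Order.lean`) — we do NOT hand-roll an order formula —,
`BoundedFormula.IsQF` (`Complexity.lean`), `BoundedFormula.alls`, `Theory.ModelsBoundedFormula`
(`⊨ᵇ`), `Theory.models_of_models_theory`, `Theory.models_sentence_of_mem`, `Nat.size`.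

## Design choices

* `FirstOrder.Language.boundedArith`, `FirstOrder.Language.Theory.Extends` and
  `FirstOrder.Language.Theory.IsConservativeOver` are deliberately placed in Mathlib's
  `FirstOrder.Language` namespace (dot-notation extensions, exactly like
  `FirstOrder.Language.presburger`); everything else is in `Literature.CplxMeta`.
* The `IsOrdered`/`Structure ℕ`/`OrderedStructure ℕ` instances are canonical instances on a
  *new* language, hence do not override anything in Mathlib.
* Mathlib's `BoundedFormula` has the primitive constructors `falsum, equal, rel, imp, all`;
  `∼φ = φ ⟹ ⊥`, `φ ⊓ ψ = ∼(φ ⟹ ∼ψ)`, `φ ⊔ ψ = ∼φ ⟹ ψ`, `∃' φ = ∼(∀' ∼φ)`. Buss's closure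
  clauses ("closed under `∧`, `∨`; `¬` of the dual class; `B → A` for `B` in the dual class")
  are therefore phrased as the single clause "`φ ⟹ ψ` is `Σᵇᵢ₊₁` when `φ` is `Πᵇᵢ₊₁` and `ψ` is
  `Σᵇᵢ₊₁`" (and dually), which, together with `⊥` being sharply bounded, generates exactly
  Buss's closure under `¬`(dual), `∧`, `∨` (see the docstring of `IsSigmab`).
  Bounded quantifiers are the definitions `ballLE`, `bexLE` (generic over any ordered language)
  and the sharply bounded `ballLELen t φ := ballLE (len t) φ`, `bexLELen`.
* `Σᵇ₀ = Πᵇ₀ =` sharply bounded formulas is implemented by the clause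
  `of_isSharplyBounded : IsSharplyBounded φ → IsSigmab i φ` at every level `i` (harmless, since
  sharply bounded formulas lie in every level anyway) with all other clauses producing level
  `i + 1` only; monotonicity `Σᵇᵢ ⊆ Σᵇᵢ₊₁` is, as in Buss, a lemma (`IsSigmab.mono`).
* `Theory.Extends T₁ T₂` ("`T₂` extends `T₁`") is axiom-wise (`∀ φ ∈ T₁, T₂ ⊨ᵇ φ`), the
  Mathlib-idiomatic hypothesis shape of `Theory.models_of_models_theory`; the consequence-wise
  form is the (real) lemma `Theory.Extends.models`. `Theory.Extends` and
  `Theory.IsConservativeOver` are relations (definitions with explicit binders), not named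
  facts: nothing is to be discharged for them.
-/

namespace Literature.Computability.MetaComplexity

open FirstOrder FirstOrder.Language

/-! ## The language -/

/-- The function symbols of Buss's language of bounded arithmetic: the constant `0`, successor
`S`, halving `⌊x/2⌋`, binary length `|x|`, addition, multiplication and smash `x # y = 2^(|x|·|y|)`
(Buss 1986, §1.1). [cite: Buss1986, §1.1] -/
inductive BoundedArithFunc : ℕ → Type
  | zero : BoundedArithFunc 0
  | succ : BoundedArithFunc 1
  | half : BoundedArithFunc 1
  | len : BoundedArithFunc 1
  | add : BoundedArithFunc 2
  | mul : BoundedArithFunc 2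
  | smash : BoundedArithFunc 2
  deriving DecidableEq

/-- The relation symbols of Buss's language of bounded arithmetic: the single binary relation
`≤` (Buss 1986, §1.1). [cite: Buss1986, §1.1] -/
inductive BoundedArithRel : ℕ → Type
  | le : BoundedArithRel 2
  deriving DecidableEq

/-- Buss's first-order language of bounded arithmetic `⟨0, S, ⌊·/2⌋, |·|, +, ·, #; ≤⟩`
(Buss 1986, §1.1; Krajíček 1995, §5.2). Deliberately placed in Mathlib's `FirstOrder.Language`
namespace, following `FirstOrder.Language.presburger`. [cite: Buss1986, §1.1] -/
def _root_.FirstOrder.Language.boundedArith : Language :=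
  { Functions := BoundedArithFunc, Relations := BoundedArithRel }

/-- The language of bounded arithmetic is an ordered language: its `≤` symbol is
`BoundedArithRel.le`. This provides Mathlib's atomic formulas `Term.le`, `Term.lt`
(Buss 1986, §1.1; `Mathlib/ModelTheory/Order.lean`). [cite: Buss1986, §1.1] -/
instance instIsOrderedBoundedArith : Language.boundedArith.IsOrdered := ⟨BoundedArithRel.le⟩

/-- The standard model `ℕ` of the language of bounded arithmetic: `0`, `S x = x + 1`,
`⌊x/2⌋`, `|x| = Nat.size x` (number of binary digits), `+`, `·`, `x # y = 2 ^ (|x| * |y|)`, and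
`≤` (Buss 1986, §1.1). [cite: Buss1986, §1.1] -/
instance instStructureNatBoundedArith : Language.boundedArith.Structure ℕ where
  funMap
    | .zero, _ => 0
    | .succ, v => v 0 + 1
    | .half, v => v 0 / 2
    | .len, v => Nat.size (v 0)
    | .add, v => v 0 + v 1
    | .mul, v => v 0 * v 1
    | .smash, v => 2 ^ (Nat.size (v 0) * Nat.size (v 1))
  RelMap
    | .le, v => v 0 ≤ v 1

/-- In the standard model `ℕ` the symbol `≤` is interpreted by the order of `ℕ`
(Buss 1986, §1.1; Mathlib `Language.OrderedStructure`). [cite: Buss1986, §1.1] -/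
instance instOrderedStructureNatBoundedArith : Language.boundedArith.OrderedStructure ℕ :=
  ⟨fun _ => Iff.rfl⟩

section funMap

variable (v₀ : Fin 0 → ℕ) (v₁ : Fin 1 → ℕ) (v₂ : Fin 2 → ℕ)

/-- Interpretation of `0` in `ℕ` (Buss 1986, §1.1). [cite: Buss1986, §1.1] -/
@[simp] theorem funMap_zero :
    Structure.funMap (L := Language.boundedArith) BoundedArithFunc.zero v₀ = 0 := rfl

/-- Interpretation of `S` in `ℕ` (Buss 1986, §1.1). [cite: Buss1986, §1.1] -/
@[simp] theorem funMap_succ :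
    Structure.funMap (L := Language.boundedArith) BoundedArithFunc.succ v₁ = v₁ 0 + 1 := rfl

/-- Interpretation of `⌊·/2⌋` in `ℕ` (Buss 1986, §1.1). [cite: Buss1986, §1.1] -/
@[simp] theorem funMap_half :
    Structure.funMap (L := Language.boundedArith) BoundedArithFunc.half v₁ = v₁ 0 / 2 := rfl

/-- Interpretation of `|·|` in `ℕ`: the binary length `Nat.size` (Buss 1986, §1.1). [cite: Buss1986, §1.1] -/
@[simp] theorem funMap_len :
    Structure.funMap (L := Language.boundedArith) BoundedArithFunc.len v₁ = Nat.size (v₁ 0) :=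
  rfl

/-- Interpretation of `+` in `ℕ` (Buss 1986, §1.1). [cite: Buss1986, §1.1] -/
@[simp] theorem funMap_add :
    Structure.funMap (L := Language.boundedArith) BoundedArithFunc.add v₂ = v₂ 0 + v₂ 1 := rfl

/-- Interpretation of `·` in `ℕ` (Buss 1986, §1.1). [cite: Buss1986, §1.1] -/
@[simp] theorem funMap_mul :
    Structure.funMap (L := Language.boundedArith) BoundedArithFunc.mul v₂ = v₂ 0 * v₂ 1 := rfl

/-- Interpretation of the smash function `#` in `ℕ`: `x # y = 2 ^ (|x| * |y|)`
(Buss 1986, §1.1). [cite: Buss1986, §1.1] -/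
@[simp] theorem funMap_smash :
    Structure.funMap (L := Language.boundedArith) BoundedArithFunc.smash v₂ =
      2 ^ (Nat.size (v₂ 0) * Nat.size (v₂ 1)) := rfl

/-- Interpretation of `≤` in `ℕ` (Buss 1986, §1.1). [cite: Buss1986, §1.1] -/
@[simp] theorem relMap_le :
    Structure.RelMap (L := Language.boundedArith) BoundedArithRel.le v₂ ↔ v₂ 0 ≤ v₂ 1 :=
  Iff.rfl

end funMap

/-! ## Term formers -/

section Term

variable {α : Type}

/-- The constant term `0` of bounded arithmetic (Buss 1986, §1.1). [cite: Buss1986, §1.1] -/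
instance : Zero (Language.boundedArith.Term α) where
  zero := Constants.term (L := Language.boundedArith) BoundedArithFunc.zero

/-- The term `t₁ + t₂` of bounded arithmetic (Buss 1986, §1.1). [cite: Buss1986, §1.1] -/
instance : Add (Language.boundedArith.Term α) where
  add := Functions.apply₂ (L := Language.boundedArith) BoundedArithFunc.add

/-- The term `t₁ · t₂` of bounded arithmetic (Buss 1986, §1.1). [cite: Buss1986, §1.1] -/
instance : Mul (Language.boundedArith.Term α) where
  mul := Functions.apply₂ (L := Language.boundedArith) BoundedArithFunc.mul

/-- The successor term `S t` of bounded arithmetic (Buss 1986, §1.1). [cite: Buss1986, §1.1] -/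
def Term.succ (t : Language.boundedArith.Term α) : Language.boundedArith.Term α :=
  Functions.apply₁ (L := Language.boundedArith) BoundedArithFunc.succ t

/-- The halving term `⌊t/2⌋` of bounded arithmetic (Buss 1986, §1.1). [cite: Buss1986, §1.1] -/
def Term.half (t : Language.boundedArith.Term α) : Language.boundedArith.Term α :=
  Functions.apply₁ (L := Language.boundedArith) BoundedArithFunc.half t

/-- The length term `|t|` of bounded arithmetic (Buss 1986, §1.1). [cite: Buss1986, §1.1] -/
def Term.len (t : Language.boundedArith.Term α) : Language.boundedArith.Term α :=
  Functions.apply₁ (L := Language.boundedArith) BoundedArithFunc.len t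

/-- The smash term `t₁ # t₂` of bounded arithmetic (Buss 1986, §1.1). [cite: Buss1986, §1.1] -/
def Term.smash (t₁ t₂ : Language.boundedArith.Term α) : Language.boundedArith.Term α :=
  Functions.apply₂ (L := Language.boundedArith) BoundedArithFunc.smash t₁ t₂

/-- The numeral `S (S ⋯ (S 0))` (`k` successors) denoting the natural number `k`
(Buss 1986, §1.1). [cite: Buss1986, §1.1] -/
def natConst : ℕ → Language.boundedArith.Term α
  | 0 => 0
  | k + 1 => Term.succ (natConst k)

variable (v : α → ℕ) (t t₁ t₂ : Language.boundedArith.Term α)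

/-- Semantics of the term `0` in `ℕ` (Buss 1986, §1.1). [cite: Buss1986, §1.1] -/
@[simp] theorem realize_zero : (0 : Language.boundedArith.Term α).realize v = 0 := rfl

/-- Semantics of `+` on terms in `ℕ` (Buss 1986, §1.1). [cite: Buss1986, §1.1] -/
@[simp] theorem realize_add : (t₁ + t₂).realize v = t₁.realize v + t₂.realize v := rfl

/-- Semantics of `·` on terms in `ℕ` (Buss 1986, §1.1). [cite: Buss1986, §1.1] -/
@[simp] theorem realize_mul : (t₁ * t₂).realize v = t₁.realize v * t₂.realize v := rfl

/-- Semantics of `S` on terms in `ℕ` (Buss 1986, §1.1). [cite: Buss1986, §1.1] -/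
@[simp] theorem realize_succ : (Term.succ t).realize v = t.realize v + 1 := rfl

/-- Semantics of `⌊·/2⌋` on terms in `ℕ` (Buss 1986, §1.1). [cite: Buss1986, §1.1] -/
@[simp] theorem realize_half : (Term.half t).realize v = t.realize v / 2 := rfl

/-- Semantics of `|·|` on terms in `ℕ` (Buss 1986, §1.1). [cite: Buss1986, §1.1] -/
@[simp] theorem realize_len : (Term.len t).realize v = Nat.size (t.realize v) := rfl

/-- Semantics of `#` on terms in `ℕ` (Buss 1986, §1.1). [cite: Buss1986, §1.1] -/
@[simp] theorem realize_smash :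
    (Term.smash t₁ t₂).realize v = 2 ^ (Nat.size (t₁.realize v) * Nat.size (t₂.realize v)) :=
  rfl

/-- The numeral `natConst k` denotes `k` in `ℕ` (Buss 1986, §1.1). [cite: Buss1986, §1.1] -/
@[simp] theorem realize_natConst (k : ℕ) :
    (natConst k : Language.boundedArith.Term α).realize v = k := by
  induction k with
  | zero => rfl
  | succ k ih => simp [natConst, ih]

end Term

/-! ## Bounded quantifiers -/

section BoundedQuantifiers

variable {L : Language} [L.IsOrdered] {α : Type} {n : ℕ}

/-- The bounded universal quantifier `(∀ x ≤ t) φ`, i.e. `∀ x (x ≤ t → φ)`, for any ordered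
language; the bound `t` does not contain the quantified variable (it is a term in the outer
context, weakened by `Fin.castSucc`) (Buss 1986, §1.1). [cite: Buss1986, §1.1] -/
def ballLE (t : L.Term (α ⊕ Fin n)) (φ : L.BoundedFormula α (n + 1)) : L.BoundedFormula α n :=
  ∀' ((Term.le (&(Fin.last n)) (t.relabel (Sum.map id Fin.castSucc))) ⟹ φ)

/-- The bounded existential quantifier `(∃ x ≤ t) φ`, i.e. `∃ x (x ≤ t ∧ φ)`, for any ordered
language; the bound `t` does not contain the quantified variable (Buss 1986, §1.1). [cite: Buss1986, §1.1] -/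
def bexLE (t : L.Term (α ⊕ Fin n)) (φ : L.BoundedFormula α (n + 1)) : L.BoundedFormula α n :=
  ∃' ((Term.le (&(Fin.last n)) (t.relabel (Sum.map id Fin.castSucc))) ⊓ φ)

/-- The sharply bounded universal quantifier `(∀ x ≤ |t|) φ` of bounded arithmetic
(Buss 1986, §1.1). [cite: Buss1986, §1.1] -/
def ballLELen (t : Language.boundedArith.Term (α ⊕ Fin n))
    (φ : Language.boundedArith.BoundedFormula α (n + 1)) :
    Language.boundedArith.BoundedFormula α n :=
  ballLE (Term.len t) φ

/-- The sharply bounded existential quantifier `(∃ x ≤ |t|) φ` of bounded arithmetic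
(Buss 1986, §1.1). [cite: Buss1986, §1.1] -/
def bexLELen (t : Language.boundedArith.Term (α ⊕ Fin n))
    (φ : Language.boundedArith.BoundedFormula α (n + 1)) :
    Language.boundedArith.BoundedFormula α n :=
  bexLE (Term.len t) φ

variable {M : Type} [LE M] [L.Structure M] [L.OrderedStructure M]

/-- Semantics of the bounded universal quantifier: `(∀ x ≤ t) φ` holds iff `φ` holds for every
`a ≤ t` (Buss 1986, §1.1). [cite: Buss1986, §1.1] -/
@[simp] theorem realize_ballLE (t : L.Term (α ⊕ Fin n)) (φ : L.BoundedFormula α (n + 1))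
    (v : α → M) (xs : Fin n → M) :
    (ballLE t φ).Realize v xs ↔
      ∀ a ≤ t.realize (Sum.elim v xs), φ.Realize v (Fin.snoc xs a) := by
  simp [ballLE, Sum.elim_comp_map]

/-- Semantics of the bounded existential quantifier: `(∃ x ≤ t) φ` holds iff `φ` holds for some
`a ≤ t` (Buss 1986, §1.1). [cite: Buss1986, §1.1] -/
@[simp] theorem realize_bexLE (t : L.Term (α ⊕ Fin n)) (φ : L.BoundedFormula α (n + 1))
    (v : α → M) (xs : Fin n → M) :
    (bexLE t φ).Realize v xs ↔
      ∃ a ≤ t.realize (Sum.elim v xs), φ.Realize v (Fin.snoc xs a) := by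
  simp [bexLE, Sum.elim_comp_map]

/-- Semantics of the sharply bounded universal quantifier in `ℕ` (Buss 1986, §1.1). [cite: Buss1986, §1.1] -/
@[simp] theorem realize_ballLELen (t : Language.boundedArith.Term (α ⊕ Fin n))
    (φ : Language.boundedArith.BoundedFormula α (n + 1)) (v : α → ℕ) (xs : Fin n → ℕ) :
    (ballLELen t φ).Realize v xs ↔
      ∀ a ≤ Nat.size (t.realize (Sum.elim v xs)), φ.Realize v (Fin.snoc xs a) := by
  simp [ballLELen]

/-- Semantics of the sharply bounded existential quantifier in `ℕ` (Buss 1986, §1.1). [cite: Buss1986, §1.1] -/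
@[simp] theorem realize_bexLELen (t : Language.boundedArith.Term (α ⊕ Fin n))
    (φ : Language.boundedArith.BoundedFormula α (n + 1)) (v : α → ℕ) (xs : Fin n → ℕ) :
    (bexLELen t φ).Realize v xs ↔
      ∃ a ≤ Nat.size (t.realize (Sum.elim v xs)), φ.Realize v (Fin.snoc xs a) := by
  simp [bexLELen]

end BoundedQuantifiers

/-! ## The bounded-formula hierarchy -/

section Hierarchy

variable {α : Type}

/-- Sharply bounded formulas (`Σᵇ₀ = Πᵇ₀`, sometimes `Δᵇ₀`): the least class containing the
open (quantifier-free) formulas and closed under the propositional connectives and the sharply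
bounded quantifiers `(∀ x ≤ |t|)`, `(∃ x ≤ |t|)` (Buss 1986, §2.1, Definition; Krajíček 1995,
Def. 5.2.1). Closure under `¬, ∧, ∨` is closure under Mathlib's primitive `imp` (with `⊥`
quantifier-free). [cite: Buss1986, §2.1  Definition] -/
inductive IsSharplyBounded : ∀ {n : ℕ}, Language.boundedArith.BoundedFormula α n → Prop
  | of_isQF {n : ℕ} {φ : Language.boundedArith.BoundedFormula α n} (h : φ.IsQF) :
      IsSharplyBounded φ
  | imp {n : ℕ} {φ ψ : Language.boundedArith.BoundedFormula α n} (hφ : IsSharplyBounded φ)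
      (hψ : IsSharplyBounded ψ) : IsSharplyBounded (φ ⟹ ψ)
  | ballLELen {n : ℕ} (t : Language.boundedArith.Term (α ⊕ Fin n))
      {φ : Language.boundedArith.BoundedFormula α (n + 1)} (hφ : IsSharplyBounded φ) :
      IsSharplyBounded (ballLELen t φ)
  | bexLELen {n : ℕ} (t : Language.boundedArith.Term (α ⊕ Fin n))
      {φ : Language.boundedArith.BoundedFormula α (n + 1)} (hφ : IsSharplyBounded φ) :
      IsSharplyBounded (bexLELen t φ)

mutual
/-- Buss's class `Σᵇᵢ` of bounded formulas (Buss 1986, §2.1, Definition; Krajíček 1995,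
Def. 5.2.2). `Σᵇ₀` is the class of sharply bounded formulas (clause `of_isSharplyBounded`, stated
at every level, which is harmless); `Σᵇᵢ₊₁` is the least class containing `Πᵇᵢ` and closed
under bounded `∃ x ≤ t`, sharply bounded `∀ x ≤ |t|`, `∧`, `∨`, and containing `¬ψ` and `ψ → φ`
for `ψ ∈ Πᵇᵢ₊₁`, `φ ∈ Σᵇᵢ₊₁`. On Mathlib's primitive syntax (`⊥, =, R, ⟹, ∀'`, with
`∼φ = φ ⟹ ⊥`, `φ ⊓ ψ = ∼(φ ⟹ ∼ψ)`, `φ ⊔ ψ = ∼φ ⟹ ψ`) all propositional clauses are generated by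
the single clause `imp : IsPib (i+1) φ → IsSigmab (i+1) ψ → IsSigmab (i+1) (φ ⟹ ψ)` and its dual.
Sharply bounded `∃ x ≤ |t|` is the special case `bexLE (len t)` of `bexLE`. [cite: Buss1986, §2.1  Definition] -/
inductive IsSigmab : ℕ → ∀ {n : ℕ}, Language.boundedArith.BoundedFormula α n → Prop
  | of_isSharplyBounded {i n : ℕ} {φ : Language.boundedArith.BoundedFormula α n}
      (h : IsSharplyBounded φ) : IsSigmab i φ
  | of_isPib {i n : ℕ} {φ : Language.boundedArith.BoundedFormula α n} (h : IsPib i φ) :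
      IsSigmab (i + 1) φ
  | imp {i n : ℕ} {φ ψ : Language.boundedArith.BoundedFormula α n} (hφ : IsPib (i + 1) φ)
      (hψ : IsSigmab (i + 1) ψ) : IsSigmab (i + 1) (φ ⟹ ψ)
  | bexLE {i n : ℕ} (t : Language.boundedArith.Term (α ⊕ Fin n))
      {φ : Language.boundedArith.BoundedFormula α (n + 1)} (hφ : IsSigmab (i + 1) φ) :
      IsSigmab (i + 1) (bexLE t φ)
  | ballLELen {i n : ℕ} (t : Language.boundedArith.Term (α ⊕ Fin n))
      {φ : Language.boundedArith.BoundedFormula α (n + 1)} (hφ : IsSigmab (i + 1) φ) :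
      IsSigmab (i + 1) (ballLELen t φ)
/-- Buss's class `Πᵇᵢ` of bounded formulas, dual to `IsSigmab` (Buss 1986, §2.1, Definition;
Krajíček 1995, Def. 5.2.2): `Πᵇ₀` = sharply bounded; `Πᵇᵢ₊₁` is the least class containing
`Σᵇᵢ` and closed under bounded `∀ x ≤ t`, sharply bounded `∃ x ≤ |t|`, `∧`, `∨`, and containing
`¬ψ`, `ψ → φ` for `ψ ∈ Σᵇᵢ₊₁`, `φ ∈ Πᵇᵢ₊₁`. [cite: Buss1986, §2.1  Definition] -/
inductive IsPib : ℕ → ∀ {n : ℕ}, Language.boundedArith.BoundedFormula α n → Prop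
  | of_isSharplyBounded {i n : ℕ} {φ : Language.boundedArith.BoundedFormula α n}
      (h : IsSharplyBounded φ) : IsPib i φ
  | of_isSigmab {i n : ℕ} {φ : Language.boundedArith.BoundedFormula α n} (h : IsSigmab i φ) :
      IsPib (i + 1) φ
  | imp {i n : ℕ} {φ ψ : Language.boundedArith.BoundedFormula α n} (hφ : IsSigmab (i + 1) φ)
      (hψ : IsPib (i + 1) ψ) : IsPib (i + 1) (φ ⟹ ψ)
  | ballLE {i n : ℕ} (t : Language.boundedArith.Term (α ⊕ Fin n))
      {φ : Language.boundedArith.BoundedFormula α (n + 1)} (hφ : IsPib (i + 1) φ) :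
      IsPib (i + 1) (ballLE t φ)
  | bexLELen {i n : ℕ} (t : Language.boundedArith.Term (α ⊕ Fin n))
      {φ : Language.boundedArith.BoundedFormula α (n + 1)} (hφ : IsPib (i + 1) φ) :
      IsPib (i + 1) (bexLELen t φ)
end

/-- Bounded (`Δ₀` in the language of bounded arithmetic, `= ⋃ᵢ Σᵇᵢ`) formulas: the least class
containing the open formulas and closed under the connectives and the bounded quantifiers
`(∀ x ≤ t)`, `(∃ x ≤ t)` (Buss 1986, §2.1; Krajíček 1995, §5.2). [cite: Buss1986, §2.1] -/
inductive IsBounded : ∀ {n : ℕ}, Language.boundedArith.BoundedFormula α n → Prop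
  | of_isQF {n : ℕ} {φ : Language.boundedArith.BoundedFormula α n} (h : φ.IsQF) : IsBounded φ
  | imp {n : ℕ} {φ ψ : Language.boundedArith.BoundedFormula α n} (hφ : IsBounded φ)
      (hψ : IsBounded ψ) : IsBounded (φ ⟹ ψ)
  | ballLE {n : ℕ} (t : Language.boundedArith.Term (α ⊕ Fin n))
      {φ : Language.boundedArith.BoundedFormula α (n + 1)} (hφ : IsBounded φ) :
      IsBounded (ballLE t φ)
  | bexLE {n : ℕ} (t : Language.boundedArith.Term (α ⊕ Fin n))
      {φ : Language.boundedArith.BoundedFormula α (n + 1)} (hφ : IsBounded φ) :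
      IsBounded (bexLE t φ)

/-- `∀Σᵇᵢ` sentences: universal closures `∀ x₁ ⋯ ∀ xₙ ψ` of `Σᵇᵢ` formulas `ψ` (Buss 1986,
§2.1; these are the sentences for which conservativity results such as
"`S₂ⁱ⁺¹` is `∀Σᵇᵢ₊₁`-conservative over `T₂ⁱ`" are stated, Buss 1990). [cite: Buss1986, §2.1] -/
def IsForallSigmab (i : ℕ) (φ : Language.boundedArith.Sentence) : Prop :=
  ∃ (n : ℕ) (ψ : Language.boundedArith.BoundedFormula Empty n), IsSigmab i ψ ∧ φ = ψ.alls

variable {n : ℕ}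

/-- `⊥` is sharply bounded (it is quantifier-free) (Buss 1986, §2.1). [cite: Buss1986, §2.1] -/
theorem IsSharplyBounded.falsum : IsSharplyBounded (⊥ : Language.boundedArith.BoundedFormula α n) :=
  .of_isQF .falsum

/-- Sharply bounded formulas are closed under negation (Buss 1986, §2.1). [cite: Buss1986, §2.1] -/
theorem IsSharplyBounded.not {φ : Language.boundedArith.BoundedFormula α n}
    (h : IsSharplyBounded φ) : IsSharplyBounded (∼φ) :=
  h.imp .falsum

/-- Sharply bounded formulas are exactly the `Σᵇ₀` formulas (Buss 1986, §2.1). [cite: Buss1986, §2.1] -/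
theorem IsSharplyBounded.isSigmab_zero {φ : Language.boundedArith.BoundedFormula α n} :
    IsSigmab 0 φ ↔ IsSharplyBounded φ :=
  ⟨fun h => by cases h; assumption, .of_isSharplyBounded⟩

/-- Sharply bounded formulas are exactly the `Πᵇ₀` formulas (Buss 1986, §2.1). [cite: Buss1986, §2.1] -/
theorem IsSharplyBounded.isPib_zero {φ : Language.boundedArith.BoundedFormula α n} :
    IsPib 0 φ ↔ IsSharplyBounded φ :=
  ⟨fun h => by cases h; assumption, .of_isSharplyBounded⟩

/-- `Πᵇᵢ ⊆ Σᵇᵢ₊₁` (Buss 1986, §2.1). [cite: Buss1986, §2.1] -/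
theorem IsPib.isSigmab_succ {i : ℕ} {φ : Language.boundedArith.BoundedFormula α n}
    (h : IsPib i φ) : IsSigmab (i + 1) φ :=
  .of_isPib h

/-- `Σᵇᵢ ⊆ Πᵇᵢ₊₁` (Buss 1986, §2.1). [cite: Buss1986, §2.1] -/
theorem IsSigmab.isPib_succ {i : ℕ} {φ : Language.boundedArith.BoundedFormula α n}
    (h : IsSigmab i φ) : IsPib (i + 1) φ :=
  .of_isSigmab h

/-- Negations of `Πᵇᵢ₊₁` formulas are `Σᵇᵢ₊₁` (Buss 1986, §2.1). [cite: Buss1986, §2.1] -/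
theorem IsPib.not {i : ℕ} {φ : Language.boundedArith.BoundedFormula α n}
    (h : IsPib (i + 1) φ) : IsSigmab (i + 1) (∼φ) :=
  .imp h (.of_isSharplyBounded .falsum)

/-- Negations of `Σᵇᵢ₊₁` formulas are `Πᵇᵢ₊₁` (Buss 1986, §2.1). [cite: Buss1986, §2.1] -/
theorem IsSigmab.not {i : ℕ} {φ : Language.boundedArith.BoundedFormula α n}
    (h : IsSigmab (i + 1) φ) : IsPib (i + 1) (∼φ) :=
  .imp h (.of_isSharplyBounded .falsum)

/-- `Σᵇᵢ₊₁` is closed under `∧` (Buss 1986, §2.1); on Mathlib syntax `φ ⊓ ψ = ∼(φ ⟹ ∼ψ)`. [cite: Buss1986, §2.1] -/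
theorem IsSigmab.inf {i : ℕ} {φ ψ : Language.boundedArith.BoundedFormula α n}
    (hφ : IsSigmab (i + 1) φ) (hψ : IsSigmab (i + 1) ψ) : IsSigmab (i + 1) (φ ⊓ ψ) :=
  (IsPib.imp hφ hψ.not).not

/-- `Σᵇᵢ₊₁` is closed under `∨` (Buss 1986, §2.1); on Mathlib syntax `φ ⊔ ψ = ∼φ ⟹ ψ`. [cite: Buss1986, §2.1] -/
theorem IsSigmab.sup {i : ℕ} {φ ψ : Language.boundedArith.BoundedFormula α n}
    (hφ : IsSigmab (i + 1) φ) (hψ : IsSigmab (i + 1) ψ) : IsSigmab (i + 1) (φ ⊔ ψ) :=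
  .imp hφ.not hψ

/-- The hierarchy is cumulative: `Σᵇᵢ ⊆ Σᵇⱼ` for `i ≤ j` (Buss 1986, §2.1, remark after the
Definition; proved by simultaneous induction with the `Πᵇ` statement). [cite: Buss1986, §2.1  remark after the Definition] -/
def IsSigmab.mono : Prop :=
  ∀ {i j : ℕ} (hij : i ≤ j) {φ : Language.boundedArith.BoundedFormula α n} (h : IsSigmab i φ),
    IsSigmab j φ

/-- The hierarchy is cumulative: `Πᵇᵢ ⊆ Πᵇⱼ` for `i ≤ j` (Buss 1986, §2.1). [cite: Buss1986, §2.1] -/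
def IsPib.mono : Prop :=
  ∀ {i j : ℕ} (hij : i ≤ j) {φ : Language.boundedArith.BoundedFormula α n} (h : IsPib i φ),
    IsPib j φ

/-- Sharply bounded formulas are bounded (Buss 1986, §2.1). [cite: Buss1986, §2.1] -/
theorem IsSharplyBounded.isBounded {φ : Language.boundedArith.BoundedFormula α n}
    (h : IsSharplyBounded φ) : IsBounded φ := by
  induction h with
  | of_isQF h => exact .of_isQF h
  | imp _ _ ihφ ihψ => exact .imp ihφ ihψ
  | ballLELen t _ ih => exact .ballLE _ ih
  | bexLELen t _ ih => exact .bexLE _ ih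

/-- `Σᵇᵢ` formulas are bounded (Buss 1986, §2.1: `Δ₀ = ⋃ᵢ Σᵇᵢ`). [cite: Buss1986, §2.1:  Δ₀ = ⋃ᵢ Σᵇᵢ] -/
def IsSigmab.isBounded : Prop :=
  ∀ {i : ℕ} {φ : Language.boundedArith.BoundedFormula α n} (h : IsSigmab i φ),
    IsBounded φ

/-- Every bounded formula lies in some `Σᵇᵢ` (Buss 1986, §2.1: `Δ₀ = ⋃ᵢ Σᵇᵢ`). [cite: Buss1986, §2.1:  Δ₀ = ⋃ᵢ Σᵇᵢ] -/
def IsBounded.exists_isSigmab : Prop :=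
  ∀ {φ : Language.boundedArith.BoundedFormula α n} (h : IsBounded φ),
    ∃ i, IsSigmab i φ

end Hierarchy

end Literature.Computability.MetaComplexity

/-! ## Generic notions on theories: extension and conservativity -/

namespace FirstOrder.Language.Theory

variable {L : Language}

/-- `T₁.Extends T₂` means that the theory `T₂` extends `T₁`: every axiom of `T₁` is a semantic
consequence of `T₂` (axiom-wise form; the consequence-wise form is `Extends.models`). This is a
binary *relation* on theories — a definition, not a named fact: its universal closure
`∀ T₁ T₂, T₁.Extends T₂` is false (e.g. `({⊥} : L.Theory).Extends ∅` fails in any nonempty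
structure), so there is no `Extends_holds`; the binders `T₁ T₂` are written explicitly in the
header for that reason. Deliberate dot-notation extension of Mathlib's
`FirstOrder.Language.Theory` namespace; Mathlib has no such notion (cf. the hypothesis of
`Theory.models_of_models_theory`). Standard usage: Krajíček 1995, Lemma 5.2.8 (p. 68), "for all
`i ≥ 1`: `S₂ⁱ ⊆ T₂ⁱ ⊆ S₂ⁱ⁺¹`", proved there axiom by axiom (each induction axiom of the smaller
theory is derived in the larger); Buss 1986, Ch. 2.
[cite: Krajicek1995, Lemma 5.2.8 (p. 68): theory inclusion `T₂ⁱ ⊆ S₂ⁱ⁺¹`, used axiom-wise] -/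
protected def Extends (T₁ T₂ : L.Theory) : Prop :=
  ∀ φ ∈ T₁, T₂ ⊨ᵇ φ

/-- `T₂.IsConservativeOver T₁ Φ`: the theory `T₂` is `Φ`-conservative over `T₁`, i.e. every
sentence of the class `Φ` provable in `T₂` is already provable in `T₁` (a ternary relation on
theories and sentence classes — a definition, not a named fact). Example of use: "for `i ≥ 1`
the theory `S₂ⁱ⁺¹` is `Σᵇᵢ₊₁`-conservative over … the theory `T₂ⁱ`" (Krajíček 1995, Cor. 7.2.4,
p. 100; a result of Buss 1990). Deliberate dot-notation extension of Mathlib's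
`FirstOrder.Language.Theory` namespace; Mathlib has none.
[cite: Krajicek1995, Cor. 7.2.4 (p. 100): usage `S₂ⁱ⁺¹` is `Σᵇᵢ₊₁`-conservative over `T₂ⁱ`] -/
def IsConservativeOver (T₂ T₁ : L.Theory) (Φ : Set L.Sentence) : Prop :=
  ∀ φ ∈ Φ, T₂ ⊨ᵇ φ → T₁ ⊨ᵇ φ

variable {T₁ T₂ T₃ : L.Theory}

/-- Consequence-wise form of extension: if `T₂` extends `T₁` then every consequence of `T₁` is
a consequence of `T₂` (Mathlib `Theory.models_of_models_theory`). [folklore] -/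
theorem Extends.models (h : T₁.Extends T₂) {φ : L.Sentence} (hφ : T₁ ⊨ᵇ φ) : T₂ ⊨ᵇ φ :=
  Theory.models_of_models_theory h hφ

/-- A supertheory extends its subtheories (Mathlib `Theory.models_sentence_of_mem`). [folklore] -/
theorem Extends.of_subset (h : T₁ ⊆ T₂) : T₁.Extends T₂ :=
  fun _ hφ => Theory.models_sentence_of_mem (h hφ)

/-- Every theory extends itself. [folklore] -/
theorem Extends.refl (T : L.Theory) : T.Extends T :=
  .of_subset subset_rfl

/-- Extension of theories is transitive. [folklore] -/
theorem Extends.trans (h₁₂ : T₁.Extends T₂) (h₂₃ : T₂.Extends T₃) : T₁.Extends T₃ :=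
  fun φ hφ => h₂₃.models (h₁₂ φ hφ)

/-- Every theory is `Φ`-conservative over itself, for every class `Φ`. [folklore] -/
theorem IsConservativeOver.refl (T : L.Theory) (Φ : Set L.Sentence) : T.IsConservativeOver T Φ :=
  fun _ _ h => h

/-- `Φ`-conservativity is transitive. [folklore] -/
theorem IsConservativeOver.trans {Φ : Set L.Sentence} (h₃₂ : T₃.IsConservativeOver T₂ Φ)
    (h₂₁ : T₂.IsConservativeOver T₁ Φ) : T₃.IsConservativeOver T₁ Φ :=
  fun φ hφ h => h₂₁ φ hφ (h₃₂ φ hφ h)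

/-- `Φ`-conservativity is antitone in the class `Φ`. [folklore] -/
theorem IsConservativeOver.anti {Φ Ψ : Set L.Sentence} (hΨΦ : Ψ ⊆ Φ)
    (h : T₂.IsConservativeOver T₁ Φ) : T₂.IsConservativeOver T₁ Ψ :=
  fun φ hφ => h φ (hΨΦ hφ)

/-- If `T₂` extends `T₁` and is `Φ`-conservative over it, then `T₁` and `T₂` prove the same
`Φ`-sentences. [folklore] -/
theorem IsConservativeOver.models_iff {Φ : Set L.Sentence} (h : T₂.IsConservativeOver T₁ Φ)
    (hext : T₁.Extends T₂) {φ : L.Sentence} (hφ : φ ∈ Φ) : T₂ ⊨ᵇ φ ↔ T₁ ⊨ᵇ φ :=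
  ⟨h φ hφ, hext.models⟩

end FirstOrder.Language.Theory
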